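import Mathlib
import Summits.Ventures.PercRepro2.ThreeTermJoinLaw

/-!
# Three-terminal parts, V c: THE TYPED-HARRIS CONE IS CLOSED UNDER JOINING A PART
(blind cell PercRepro2, night-3 g31, 2026-08-30; `proofs/NIGHT3-CERT.md` §40)

`typedHarris_part` (ThreeTermPartHarris.lean, g30) says the typed partition law of EVERY typed
three-terminal part lies in the typed-Harris cone `K = {n : Sym3, n ≥ 0, TypedHarris πpat n}`.  Here the
cone itself is shown to be CLOSED under joining a part: for an ABSTRACT law `n ∈ K` — realisable by a
part or not (the 15 unrealisable extreme rays of §39.4 included) — and any typed part `(S, τ, pat)`,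
the JOINED law

  `joinLaw n S τ pat i j k = Σ_{a b c} Σ_{x y z typed} [a ⊔ pat x = i] [b ⊔ pat y = j] [c ⊔ pat z = k] · n a b c`

(the pattern of copy `i` is the join of the abstract pattern and the part's pattern, the part's typed
triple independent of `n`) is again in `K`:

* the typed Harris sum of the joined law collapses to a sum over `(a, b, c)` and typed triples
  `(x, y, z)` of `n a b c · hh s (π (b ⊔ pat y)) (π (c ⊔ pat z))` (`joinHarris_hh`, ThreeTermJoinLaw.lean);
* CONDITIONING ON COPY 1 `(a, x)`: the typed pairs `(y, z)` are the antipodal cube of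
  ThreeTermAntipode.lean, and the inner sum at `(b, c)` is `#{cube : P_b ∧ Q_b} − #{cube : P_b ∧ Q_c ∘ ant}`
  with `P_b = {y | π (b ⊔ pat y) ∈ U_S}`, `Q_c = {y | π (c ⊔ pat y) ∈ U_S′}` — upper sets (`uL_orP_mono`, `uR_orP_mono` + `isUpperSet_pat`);
* the mixed Harris inequality bounds the antipodal count by `κ · #{P_b} · #{Q_c}` (`antipodal_mixed`,
  `κ = (½)^{|Sp|}`, ThreeTermJoinLaw.lean) and Harris bounds `κ · #{P_b} · #{Q_b}` by `#{P_b ∧ Q_b}` (`cube_harris`);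
* in between, TYPED HARRIS OF `n` ON EVERY PAIR OF UP-SETS (`typedHarris_pairs`, ThreeTermUpsetPairs.lean)
  gives `Σ_{b c} n a b c · #{P_b} · #{Q_c} ≤ Σ_{b c} n a b c · #{P_b} · #{Q_b}`: for fixed cube points
  `y, y′` the events `{b | π (b ⊔ pat y) ∈ U_S}` are up-set events of `n`'s own copies (`up5_orP`);
* **`typedHarris_join`**: `TypedHarris πpat (joinLaw n S τ (pat ends S e₁ e₂ e₃ t₁ t₂ t₃))` for every
  `n ∈ K` and every part — with `joinLaw_sym`, `joinLaw_nonneg`: `K ⋆ (parts) ⊆ K`.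

COROLLARY — THE DUAL CONE CONDITION IS HEREDITARY: `DualCone T := ∀ n ∈ K, 0 ≤ Σ n · T` (the dual form
of the cone certificate, implied by `InConeP πpat (cubicOf T)`: `dualCone_of_inConeP`); if a core's
table `T` satisfies it at `(t₁, t₂, t₃)`, so does the JOINED table `joinTable T S τ pat` (the table
of core + a part attached at the same terminals, the patterns of the core's table joined with the
part's typed configurations): `dualCone_join`.  In particular typed edges between the terminals may
be deleted WLOG when the cone condition of a core is examined.  The identification of `joinTable`
with `partTable` of the enlarged core is the connectivity statement «the part map of a union of two
parts at the same terminals is the join of the part maps» — stated in §40, not typed here.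

Own work; standard axioms.
-/

namespace Summit.Ventures.PercRepro2

open Block ThreeTerm TypedStar

namespace Part

/-! ## The inner inequality at a fixed copy 1 -/

section Inner

variable {E : Type*} [Fintype E] [DecidableEq E]

/-- Commuting two outer sums past two inner sums. -/
lemma sum22_comm {A B X Y : Type*} [Fintype A] [Fintype B] [Fintype X] [Fintype Y]
    (f : A → B → X → Y → ℚ) : (∑ a, ∑ b, ∑ x, ∑ y, f a b x y) = ∑ x, ∑ y, ∑ a, ∑ b, f a b x y :=
  calc (∑ a, ∑ b, ∑ x, ∑ y, f a b x y)
      = ∑ u : A × B, ∑ v : X × Y, f u.1 u.2 v.1 v.2 := by simp only [Fintype.sum_prod_type]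
    _ = ∑ v : X × Y, ∑ u : A × B, f u.1 u.2 v.1 v.2 := Finset.sum_comm
    _ = ∑ x, ∑ y, ∑ a, ∑ b, f a b x y := by simp only [Fintype.sum_prod_type]

/-- The indicator of an up-set event of the joined pattern is an `ind5` of the abstract pattern. -/
lemma ind_orP_eq (u : Fin 10) (p : Fin 8) : ∃ u' : Fin 10, ∀ b : Fin 8,
    (if up5 u (πpat (orP b p)) = true then (1 : ℚ) else 0) = ind5 u' (πpat b) := by
  obtain ⟨u', hu'⟩ := up5_orP u p
  exact ⟨u', fun b => by simp only [ind5, hu' b]⟩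

/-- **Step (γ): the product of the two marginal counts is dominated through typed Harris of `n`.**
For fixed cube points, `Σ_{b c} n a b c · [P_b y] · [Q_c y′] ≤ Σ_{b c} n a b c · [P_b y] · [Q_b y′]`,
summed over the cube. -/
lemma sum_marginals_le {n : Fin 8 → Fin 8 → Fin 8 → ℚ} (hn : Sym3 n) (hn0 : ∀ i j k, 0 ≤ n i j k)
    (hH : TypedHarris πpat n) (S : Finset E) (τ : E → ℕ) (x : Config E) (pat : Config E → Fin 8)
    (s : Fin 9) (a : Fin 8) :
    (∑ b : Fin 8, ∑ c : Fin 8, n a b c *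
        ((∑ y : Config E, if InCube S τ x y ∧ uL s (πpat (orP b (pat y))) = true then (1 : ℚ) else 0) *
          ∑ y : Config E, if InCube S τ x y ∧ uR s (πpat (orP c (pat y))) = true then (1 : ℚ) else 0)) ≤
      ∑ b : Fin 8, ∑ c : Fin 8, n a b c *
        ((∑ y : Config E, if InCube S τ x y ∧ uL s (πpat (orP b (pat y))) = true then (1 : ℚ) else 0) *
          ∑ y : Config E, if InCube S τ x y ∧ uR s (πpat (orP b (pat y))) = true then (1 : ℚ) else 0) := by
  obtain ⟨uLs, hLs⟩ := uL_eq_up5 s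
  obtain ⟨uRs, hRs⟩ := uR_eq_up5 s
  -- expand the products of counts into double sums over cube points
  have expand : ∀ (b c : Fin 8),
      n a b c * ((∑ y : Config E, if InCube S τ x y ∧ uL s (πpat (orP b (pat y))) = true then (1 : ℚ) else 0) *
          ∑ y : Config E, if InCube S τ x y ∧ uR s (πpat (orP c (pat y))) = true then (1 : ℚ) else 0) =
      ∑ y : Config E, ∑ y' : Config E,
        if InCube S τ x y ∧ InCube S τ x y' then
          n a b c * ((if up5 uLs (πpat (orP b (pat y))) = true then (1 : ℚ) else 0) *
            (if up5 uRs (πpat (orP c (pat y'))) = true then (1 : ℚ) else 0))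
        else 0 := by
    intro b c
    rw [Finset.sum_mul_sum, Finset.mul_sum]
    refine Finset.sum_congr rfl fun y _ => ?_
    rw [Finset.mul_sum]
    refine Finset.sum_congr rfl fun y' _ => ?_
    simp only [hLs, hRs]
    by_cases hA : InCube S τ x y
    · by_cases hA' : InCube S τ x y'
      · simp [eq_true hA, eq_true hA']
      · simp [eq_true hA, eq_false hA']
    · by_cases hA' : InCube S τ x y'
      · simp [eq_false hA, eq_true hA']
      · simp [eq_false hA, eq_false hA']
  have eL : (∑ b : Fin 8, ∑ c : Fin 8, n a b c *
        ((∑ y : Config E, if InCube S τ x y ∧ uL s (πpat (orP b (pat y))) = true then (1 : ℚ) else 0) *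
          ∑ y : Config E, if InCube S τ x y ∧ uR s (πpat (orP c (pat y))) = true then (1 : ℚ) else 0)) =
      ∑ y : Config E, ∑ y' : Config E, ∑ b : Fin 8, ∑ c : Fin 8,
        if InCube S τ x y ∧ InCube S τ x y' then
          n a b c * ((if up5 uLs (πpat (orP b (pat y))) = true then (1 : ℚ) else 0) *
            (if up5 uRs (πpat (orP c (pat y'))) = true then (1 : ℚ) else 0))
        else 0 := by
    simp only [expand]
    exact sum22_comm _
  have eR : (∑ b : Fin 8, ∑ c : Fin 8, n a b c *
        ((∑ y : Config E, if InCube S τ x y ∧ uL s (πpat (orP b (pat y))) = true then (1 : ℚ) else 0) *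
          ∑ y : Config E, if InCube S τ x y ∧ uR s (πpat (orP b (pat y))) = true then (1 : ℚ) else 0)) =
      ∑ y : Config E, ∑ y' : Config E, ∑ b : Fin 8, ∑ c : Fin 8,
        if InCube S τ x y ∧ InCube S τ x y' then
          n a b c * ((if up5 uLs (πpat (orP b (pat y))) = true then (1 : ℚ) else 0) *
            (if up5 uRs (πpat (orP b (pat y'))) = true then (1 : ℚ) else 0))
        else 0 := by
    have e1 : ∀ (b c : Fin 8), n a b c *
        ((∑ y : Config E, if InCube S τ x y ∧ uL s (πpat (orP b (pat y))) = true then (1 : ℚ) else 0) *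
          ∑ y : Config E, if InCube S τ x y ∧ uR s (πpat (orP b (pat y))) = true then (1 : ℚ) else 0) =
        ∑ y : Config E, ∑ y' : Config E,
          if InCube S τ x y ∧ InCube S τ x y' then
            n a b c * ((if up5 uLs (πpat (orP b (pat y))) = true then (1 : ℚ) else 0) *
              (if up5 uRs (πpat (orP b (pat y'))) = true then (1 : ℚ) else 0))
          else 0 := by
      intro b c
      clear expand
      rw [Finset.sum_mul_sum, Finset.mul_sum]
      refine Finset.sum_congr rfl fun y _ => ?_
      rw [Finset.mul_sum]
      refine Finset.sum_congr rfl fun y' _ => ?_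
      simp only [hLs, hRs]
      by_cases hA : InCube S τ x y
      · by_cases hA' : InCube S τ x y'
        · simp [eq_true hA, eq_true hA']
        · simp [eq_true hA, eq_false hA']
      · by_cases hA' : InCube S τ x y'
        · simp [eq_false hA, eq_true hA']
        · simp [eq_false hA, eq_false hA']
    simp only [e1]
    exact sum22_comm _
  rw [eL, eR]
  refine Finset.sum_le_sum fun y _ => Finset.sum_le_sum fun y' _ => ?_
  by_cases hyy : InCube S τ x y ∧ InCube S τ x y'
  · simp only [eq_true hyy, if_true]
    obtain ⟨u₁, hu₁⟩ := ind_orP_eq uLs (pat y)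
    obtain ⟨u₂, hu₂⟩ := ind_orP_eq uRs (pat y')
    simp only [hu₁, hu₂]
    exact typedHarris_pairs hn hn0 hH a u₁ u₂
  · simp [eq_false hyy]

/-- The inner sum at a fixed copy 1 as a difference of two counts. -/
lemma inner_eq_counts (S : Finset E) (τ : E → ℕ) (x : Config E) (pat : Config E → Fin 8) (s : Fin 9)
    (b c : Fin 8) :
    (∑ y : Config E, if InCube S τ x y then
        hh s (πpat (orP b (pat y))) (πpat (orP c (pat (ant S τ x y)))) else 0) =
      (∑ y : Config E, if InCube S τ x y ∧ uL s (πpat (orP b (pat y))) = true ∧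
          uR s (πpat (orP b (pat y))) = true then (1 : ℚ) else 0) -
      ∑ y : Config E, if InCube S τ x y ∧ uL s (πpat (orP b (pat y))) = true ∧
          uR s (πpat (orP c (pat (ant S τ x y)))) = true then (1 : ℚ) else 0 := by
  rw [← Finset.sum_sub_distrib]
  refine Finset.sum_congr rfl fun y _ => ?_
  simp only [hh]
  exact ite_decomp _ _ _ _

/-- **THE INNER INEQUALITY AT A FIXED COPY 1**: `0 ≤ Σ_{b c} n a b c · Σ_{y z typed} hh s (π (b ⊔ pat y)) (π (c ⊔ pat z))`
when every joined up-set event is an upper set. -/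
theorem join_inner_nonneg {n : Fin 8 → Fin 8 → Fin 8 → ℚ} (hn : Sym3 n) (hn0 : ∀ i j k, 0 ≤ n i j k)
    (hH : TypedHarris πpat n) (S : Finset E) (τ : E → ℕ) (pat : Config E → Fin 8) (s : Fin 9)
    (hL : ∀ b : Fin 8, IsUpperSet {y : Config E | uL s (πpat (orP b (pat y))) = true})
    (hR : ∀ c : Fin 8, IsUpperSet {y : Config E | uR s (πpat (orP c (pat y))) = true})
    (a : Fin 8) (x : Config E) :
    0 ≤ ∑ b : Fin 8, ∑ c : Fin 8, n a b c * ∑ y : Config E, ∑ z : Config E,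
      if (SuppOn S x ∧ SuppOn S y ∧ SuppOn S z) ∧ ∀ e ∈ S, openCount x y z e = τ e
        then hh s (πpat (orP b (pat y))) (πpat (orP c (pat z))) else 0 := by
  by_cases hx : SuppOn S x ∧ Adm S τ x
  · set κ : ℚ := (1 / 2 : ℚ) ^ (splitSet S τ x).card with hκ
    have hκ0 : 0 ≤ κ := by positivity
    -- the two counts
    set NL : Fin 8 → ℚ := fun b =>
      ∑ y : Config E, if InCube S τ x y ∧ uL s (πpat (orP b (pat y))) = true then (1 : ℚ) else 0 with hNL
    set NR : Fin 8 → ℚ := fun c =>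
      ∑ y : Config E, if InCube S τ x y ∧ uR s (πpat (orP c (pat y))) = true then (1 : ℚ) else 0 with hNR
    have step1 : ∀ b c : Fin 8,
        (∑ y : Config E, ∑ z : Config E,
          if (SuppOn S x ∧ SuppOn S y ∧ SuppOn S z) ∧ ∀ e ∈ S, openCount x y z e = τ e
            then hh s (πpat (orP b (pat y))) (πpat (orP c (pat z))) else 0) ≥
        κ * (NL b * NR b) - κ * (NL b * NR c) := by
      intro b c
      rw [sum_typed S τ x hx.1 hx.2 (fun y z => hh s (πpat (orP b (pat y))) (πpat (orP c (pat z))))]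
      rw [inner_eq_counts]
      have hA := antipodal_mixed S τ x (fun y => uL s (πpat (orP b (pat y))) = true)
        (fun y => uR s (πpat (orP c (pat y))) = true) (hL b) (hR c)
      have hB := cube_harris S τ x (fun y => uL s (πpat (orP b (pat y))) = true)
        (fun y => uR s (πpat (orP b (pat y))) = true) (hL b) (hR b)
      simp only [hNL, hNR, hκ] at hA hB ⊢
      linarith
    have step2 : (∑ b : Fin 8, ∑ c : Fin 8, n a b c * (NL b * NR c)) ≤
        ∑ b : Fin 8, ∑ c : Fin 8, n a b c * (NL b * NR b) :=
      sum_marginals_le hn hn0 hH S τ x pat s a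
    calc (0 : ℚ) = κ * ((∑ b : Fin 8, ∑ c : Fin 8, n a b c * (NL b * NR b)) -
            ∑ b : Fin 8, ∑ c : Fin 8, n a b c * (NL b * NR c)) - κ * ((∑ b : Fin 8, ∑ c : Fin 8,
            n a b c * (NL b * NR b)) - ∑ b : Fin 8, ∑ c : Fin 8, n a b c * (NL b * NR c)) := by ring
      _ ≤ κ * ((∑ b : Fin 8, ∑ c : Fin 8, n a b c * (NL b * NR b)) -
            ∑ b : Fin 8, ∑ c : Fin 8, n a b c * (NL b * NR c)) := by
          have : 0 ≤ κ * ((∑ b : Fin 8, ∑ c : Fin 8, n a b c * (NL b * NR b)) -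
              ∑ b : Fin 8, ∑ c : Fin 8, n a b c * (NL b * NR c)) :=
            mul_nonneg hκ0 (sub_nonneg.2 step2)
          linarith
      _ = ∑ b : Fin 8, ∑ c : Fin 8, n a b c * (κ * (NL b * NR b) - κ * (NL b * NR c)) := by
          simp only [mul_sub, Finset.mul_sum, Finset.sum_sub_distrib]
          refine congrArg₂ (· - ·) ?_ ?_ <;>
            refine Finset.sum_congr rfl fun b _ => Finset.sum_congr rfl fun c _ => by ring
      _ ≤ ∑ b : Fin 8, ∑ c : Fin 8, n a b c * ∑ y : Config E, ∑ z : Config E,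
            if (SuppOn S x ∧ SuppOn S y ∧ SuppOn S z) ∧ ∀ e ∈ S, openCount x y z e = τ e
              then hh s (πpat (orP b (pat y))) (πpat (orP c (pat z))) else 0 := by
          refine Finset.sum_le_sum fun b _ => Finset.sum_le_sum fun c _ => ?_
          exact mul_le_mul_of_nonneg_left (step1 b c) (hn0 a b c)
  · refine Finset.sum_nonneg fun b _ => Finset.sum_nonneg fun c _ => ?_
    refine mul_nonneg (hn0 a b c) ?_
    refine Finset.sum_nonneg fun y _ => Finset.sum_nonneg fun z _ => ?_
    rw [if_neg (not_typed S τ x hx y z)]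

end Inner

/-! ## The joined up-set events are upper sets, and the theorem -/

section Main

variable {V : Type*} {E : Type*} [Fintype E] [DecidableEq E]

/-- `uL s ∘ πpat ∘ (b ⊔ ·)` is bit-monotone, for every `b`. -/
lemma uL_orP_mono : ∀ (s : Fin 9) (b : Fin 8) (b0 b1 b2 b0' b1' b2' : Bool),
    b0 ≤ b0' → b1 ≤ b1' → b2 ≤ b2' →
    uL s (πpat (orP b (patOf b0 b1 b2))) = true → uL s (πpat (orP b (patOf b0' b1' b2'))) = true := by
  decide

/-- `uR s ∘ πpat ∘ (c ⊔ ·)` is bit-monotone, for every `c`. -/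
lemma uR_orP_mono : ∀ (s : Fin 9) (c : Fin 8) (b0 b1 b2 b0' b1' b2' : Bool),
    b0 ≤ b0' → b1 ≤ b1' → b2 ≤ b2' →
    uR s (πpat (orP c (patOf b0 b1 b2))) = true → uR s (πpat (orP c (patOf b0' b1' b2'))) = true := by
  decide

/-- **THE TYPED-HARRIS CONE IS CLOSED UNDER JOINING A PART**: for an abstract law `n ∈ K` and ANY typed
three-terminal part `(S, τ)` with pattern map `pat ends S e₁ e₂ e₃ t₁ t₂ t₃`, the joined law satisfies
the typed Harris condition. -/
theorem typedHarris_join (ends : E → Sym2 V) (S : Finset E) (e₁ e₂ e₃ : E) (t₁ t₂ t₃ : V) (τ : E → ℕ)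
    {n : Fin 8 → Fin 8 → Fin 8 → ℚ} (hn : Sym3 n) (hn0 : ∀ i j k, 0 ≤ n i j k)
    (hH : TypedHarris πpat n) :
    TypedHarris πpat (joinLaw n S τ (pat ends S e₁ e₂ e₃ t₁ t₂ t₃)) := by
  intro a' s
  rw [joinHarris_hh n hn]
  have hL : ∀ b : Fin 8, IsUpperSet {y : Config E |
      uL s (πpat (orP b (pat ends S e₁ e₂ e₃ t₁ t₂ t₃ y))) = true} := fun b =>
    isUpperSet_pat ends S e₁ e₂ e₃ t₁ t₂ t₃ (fun i => uL s (πpat (orP b i))) (uL_orP_mono s b)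
  have hR : ∀ c : Fin 8, IsUpperSet {y : Config E |
      uR s (πpat (orP c (pat ends S e₁ e₂ e₃ t₁ t₂ t₃ y))) = true} := fun c =>
    isUpperSet_pat ends S e₁ e₂ e₃ t₁ t₂ t₃ (fun i => uR s (πpat (orP c i))) (uR_orP_mono s c)
  refine Finset.sum_nonneg fun a _ => ?_
  -- bring the copy-1 sum out past the copy-2, copy-3 pattern sums
  have hcomm : (∑ b : Fin 8, ∑ c : Fin 8, ∑ x : Config E, ∑ y : Config E, ∑ z : Config E,
      if ((SuppOn S x ∧ SuppOn S y ∧ SuppOn S z) ∧ (∀ e ∈ S, openCount x y z e = τ e)) ∧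
          orP a (pat ends S e₁ e₂ e₃ t₁ t₂ t₃ x) = a'
        then n a b c * hh s (πpat (orP b (pat ends S e₁ e₂ e₃ t₁ t₂ t₃ y)))
          (πpat (orP c (pat ends S e₁ e₂ e₃ t₁ t₂ t₃ z))) else 0) =
      ∑ x : Config E, ∑ b : Fin 8, ∑ c : Fin 8, ∑ y : Config E, ∑ z : Config E,
      if ((SuppOn S x ∧ SuppOn S y ∧ SuppOn S z) ∧ (∀ e ∈ S, openCount x y z e = τ e)) ∧
          orP a (pat ends S e₁ e₂ e₃ t₁ t₂ t₃ x) = a'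
        then n a b c * hh s (πpat (orP b (pat ends S e₁ e₂ e₃ t₁ t₂ t₃ y)))
          (πpat (orP c (pat ends S e₁ e₂ e₃ t₁ t₂ t₃ z))) else 0 := by
    exact sum_x_out _
  rw [hcomm]
  refine Finset.sum_nonneg fun x _ => ?_
  by_cases ha : orP a (pat ends S e₁ e₂ e₃ t₁ t₂ t₃ x) = a'
  · have key := join_inner_nonneg hn hn0 hH S τ (pat ends S e₁ e₂ e₃ t₁ t₂ t₃) s hL hR a x
    calc (0 : ℚ) ≤ _ := key
      _ = _ := by
        simp only [Finset.mul_sum]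
        refine Finset.sum_congr rfl fun b _ => Finset.sum_congr rfl fun c _ =>
          Finset.sum_congr rfl fun y _ => Finset.sum_congr rfl fun z _ => ?_
        rw [if_congr (and_iff_left ha) rfl rfl]
        split_ifs <;> simp
  · refine Finset.sum_nonneg fun b _ => Finset.sum_nonneg fun c _ =>
      Finset.sum_nonneg fun y _ => Finset.sum_nonneg fun z _ => ?_
    rw [if_neg (fun h => ha h.2)]

end Main

/-! ## Corollary: the dual cone condition is hereditary under attaching a part at the terminals -/

section Dual

variable {V : Type*} {E : Type*} [Fintype E] [DecidableEq E]

/-- **The dual cone condition** on a coefficient array `T` (a core's table): every law of the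
typed-Harris cone contracts nonnegatively with it. -/
def DualCone (T : Fin 8 → Fin 8 → Fin 8 → ℚ) : Prop :=
  ∀ n : Fin 8 → Fin 8 → Fin 8 → ℚ, Sym3 n → (∀ i j k, 0 ≤ n i j k) → TypedHarris πpat n →
    0 ≤ ∑ i : Fin 8, ∑ j : Fin 8, ∑ k : Fin 8, n i j k * T i j k

/-- A primal certificate implies the dual cone condition. -/
theorem dualCone_of_inConeP {T : Fin 8 → Fin 8 → Fin 8 → ℚ} (h : InConeP πpat (cubicOf T)) :
    DualCone T := fun n hn hn0 hH => by
  have := lawSum_nonneg_of_inConeP πpat hn hn0 hH h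
  rwa [lawSum_cubicOf hn] at this

/-- **The joined table**: the table of core + a part attached at the same terminals, read from the
core's table — the patterns joined with the part's typed configurations. -/
noncomputable def joinTable (T : Fin 8 → Fin 8 → Fin 8 → ℚ) (S : Finset E) (τ : E → ℕ)
    (pat : Config E → Fin 8) (i j k : Fin 8) : ℚ :=
  ∑ x : Config E, ∑ y : Config E, ∑ z : Config E,
    if (SuppOn S x ∧ SuppOn S y ∧ SuppOn S z) ∧ (∀ e ∈ S, openCount x y z e = τ e)
      then T (orP i (pat x)) (orP j (pat y)) (orP k (pat z)) else 0

/-- A triple sum over `Fin 8` of a fibre indicator collapses (variant with the value outside). -/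
lemma sum_collapse3 (g : Fin 8 → Fin 8 → Fin 8 → ℚ) (i j k : Fin 8) :
    (∑ i' : Fin 8, ∑ j' : Fin 8, ∑ k' : Fin 8, if i = i' ∧ j = j' ∧ k = k' then g i' j' k' else 0) =
      g i j k := sum_pat_collapse g i j k

/-- Commuting three outer sums past six inner sums. -/
lemma sum36_comm {A B C X₁ X₂ X₃ X₄ X₅ X₆ : Type*} [Fintype A] [Fintype B] [Fintype C] [Fintype X₁]
    [Fintype X₂] [Fintype X₃] [Fintype X₄] [Fintype X₅] [Fintype X₆]
    (f : A → B → C → X₁ → X₂ → X₃ → X₄ → X₅ → X₆ → ℚ) :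
    (∑ a, ∑ b, ∑ c, ∑ x₁, ∑ x₂, ∑ x₃, ∑ x₄, ∑ x₅, ∑ x₆, f a b c x₁ x₂ x₃ x₄ x₅ x₆) =
      ∑ x₁, ∑ x₂, ∑ x₃, ∑ x₄, ∑ x₅, ∑ x₆, ∑ a, ∑ b, ∑ c, f a b c x₁ x₂ x₃ x₄ x₅ x₆ :=
  calc (∑ a, ∑ b, ∑ c, ∑ x₁, ∑ x₂, ∑ x₃, ∑ x₄, ∑ x₅, ∑ x₆, f a b c x₁ x₂ x₃ x₄ x₅ x₆)
      = ∑ u : A × B × C, ∑ v : X₁ × X₂ × X₃ × X₄ × X₅ × X₆,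
          f u.1 u.2.1 u.2.2 v.1 v.2.1 v.2.2.1 v.2.2.2.1 v.2.2.2.2.1 v.2.2.2.2.2 := by
        simp only [Fintype.sum_prod_type]
    _ = ∑ v : X₁ × X₂ × X₃ × X₄ × X₅ × X₆, ∑ u : A × B × C,
          f u.1 u.2.1 u.2.2 v.1 v.2.1 v.2.2.1 v.2.2.2.1 v.2.2.2.2.1 v.2.2.2.2.2 := Finset.sum_comm
    _ = ∑ x₁, ∑ x₂, ∑ x₃, ∑ x₄, ∑ x₅, ∑ x₆, ∑ a, ∑ b, ∑ c, f a b c x₁ x₂ x₃ x₄ x₅ x₆ := by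
        simp only [Fintype.sum_prod_type]

/-- **The contraction identity**: `Σ n · joinTable T = Σ joinLaw n · T`. -/
lemma sum_joinTable (n T : Fin 8 → Fin 8 → Fin 8 → ℚ) (S : Finset E) (τ : E → ℕ)
    (pat : Config E → Fin 8) :
    (∑ i : Fin 8, ∑ j : Fin 8, ∑ k : Fin 8, n i j k * joinTable T S τ pat i j k) =
      ∑ i : Fin 8, ∑ j : Fin 8, ∑ k : Fin 8, joinLaw n S τ pat i j k * T i j k := by
  have hL : (∑ i : Fin 8, ∑ j : Fin 8, ∑ k : Fin 8, n i j k * joinTable T S τ pat i j k) =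
      ∑ a : Fin 8, ∑ b : Fin 8, ∑ c : Fin 8, ∑ x : Config E, ∑ y : Config E, ∑ z : Config E,
        if (SuppOn S x ∧ SuppOn S y ∧ SuppOn S z) ∧ (∀ e ∈ S, openCount x y z e = τ e)
          then n a b c * T (orP a (pat x)) (orP b (pat y)) (orP c (pat z)) else 0 := by
    simp only [joinTable, Finset.mul_sum, mul_ite, mul_zero]
  have hR : (∑ i : Fin 8, ∑ j : Fin 8, ∑ k : Fin 8, joinLaw n S τ pat i j k * T i j k) =
      ∑ a : Fin 8, ∑ b : Fin 8, ∑ c : Fin 8, ∑ x : Config E, ∑ y : Config E, ∑ z : Config E,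
        if (SuppOn S x ∧ SuppOn S y ∧ SuppOn S z) ∧ (∀ e ∈ S, openCount x y z e = τ e)
          then n a b c * T (orP a (pat x)) (orP b (pat y)) (orP c (pat z)) else 0 := by
    simp only [joinLaw, Finset.sum_mul, ite_mul, zero_mul]
    rw [sum36_comm]
    refine Finset.sum_congr rfl fun a _ => Finset.sum_congr rfl fun b _ => Finset.sum_congr rfl fun c _ =>
      Finset.sum_congr rfl fun x _ => Finset.sum_congr rfl fun y _ => Finset.sum_congr rfl fun z _ => ?_
    by_cases h : (SuppOn S x ∧ SuppOn S y ∧ SuppOn S z) ∧ (∀ e ∈ S, openCount x y z e = τ e)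
    · rw [if_pos h, ← sum_collapse3 (fun i j k => n a b c * T i j k) (orP a (pat x)) (orP b (pat y))
        (orP c (pat z))]
      refine Finset.sum_congr rfl fun i _ => Finset.sum_congr rfl fun j _ => Finset.sum_congr rfl fun k _ => ?_
      by_cases hijk : orP a (pat x) = i ∧ orP b (pat y) = j ∧ orP c (pat z) = k
      · rw [if_pos hijk, if_pos ⟨h, hijk⟩]
      · rw [if_neg hijk, if_neg (fun h' => hijk h'.2)]
    · rw [if_neg h]
      refine Finset.sum_eq_zero fun i _ => Finset.sum_eq_zero fun j _ => Finset.sum_eq_zero fun k _ => ?_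
      rw [if_neg (fun h' => h h'.1)]
  rw [hL, hR]

/-- **THE DUAL CONE CONDITION IS HEREDITARY**: if the core's table satisfies it at `(t₁, t₂, t₃)`, so
does the joined table of core + any part attached at those terminals. -/
theorem dualCone_join {T : Fin 8 → Fin 8 → Fin 8 → ℚ} (hT : DualCone T) (ends : E → Sym2 V)
    (S : Finset E) (e₁ e₂ e₃ : E) (t₁ t₂ t₃ : V) (τ : E → ℕ) :
    DualCone (joinTable T S τ (pat ends S e₁ e₂ e₃ t₁ t₂ t₃)) := fun n hn hn0 hH => by
  rw [sum_joinTable]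
  exact hT _ (joinLaw_sym hn S τ _) (joinLaw_nonneg hn0 S τ _)
    (typedHarris_join ends S e₁ e₂ e₃ t₁ t₂ t₃ τ hn hn0 hH)

end Dual

end Part

end Summit.Ventures.PercRepro2
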